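import Summits.BirchSwinnertonDyer.BirchSwinnertonDyer.Theses.TwistFamilyManinDescent
import Literature.NumberTheory.EllipticCurves.ModularCurveManinConstantProofs

/-!
# Ordinary CM torsor — boundary rows dissolved, cusp-image lemma (crux stmt-BirchSwinnertonDyer-25138, crux-ideate seat 1, g12)

Refinement of the card `Ideas/ordinary-cm-torsor.md` (no new card): the two "boundary" rows `(5; III, v = 3)`
and `(7; II, v = 2)` (the rows of `boundary_rows`, `cwIndex = 1`) need NO special treatment, and the cusp
exit is provably closed on Case-A rows.  Kernel-checked content (no `sorry`):

* `InfinityCuspImageKilledByP`, `ZeroCuspImageDifferenceKilledByP`, `InfinityCuspImageNonzeroOnlyIfReducible`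
  — the CUSP-IMAGE LEMMA (Lemma A) typed E-facingly over the tree (`D.uniformize (c · {∞, a/d}_f)`): for `p` odd
  and `p² ∣ N`, every cusp `a/d` with `p^{v_p N} ∣ d` maps to a point killed by `p` (to `O` unless `E[p]` is
  reducible); `0`-type cusps likewise relative to `φ(0)`.  Proof route (informal, folklore inputs): the KM model
  (KM 13.4.7) puts `∞` and every `∞`-type cusp on the multiplicity-one outer component, inside the smooth locus;
  Néron mapping property (BLR 1.1) ⇒ `φ(P) ∈ E⁰(ℚ_p^{nr})`; Manin–Drinfeld ⇒ torsion;
  `0 → E₁ → E⁰(ℚ_p^{nr}) → 𝔾_a(𝔽̄_p) → 0` with `E₁` torsion-free (`e = 1 < p − 1`) ⇒ `p · φ(P) = O` and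
  `φ(P) ≠ O ⇒ E[p]^{I_p} ∩ E(ℚ(ζ_g)) ≠ 0` (`g ∣ N/p²`).  CENSUS: kit j331280 (2060 optimal classes, `N ≤ 3000`
  all `p ≥ 5`, `N ≤ 800` for `p = 3`; pilot j331270 13/13 as predicted, reproducing P1 j330552).
* `cwIndex_uniform` — on EVERY principal-series crux row the Coates–Wiles index lies in `[1, p − 2]` (never the
  unramified exponent `0`); `boundary_profile` — the boundary rows are exactly `e = p − 1 ∧ cwIndex = 1`, i.e. the
  original Coates–Wiles homomorphism `φ₁` (Lang, Cyclotomic Fields I–II, Ch. 6 §4, p. 131); `raynaudBorderline_rows`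
  — the rows with `e ≥ p − 1` (where finite-flat uniqueness is unavailable; the character computation still holds).
* `endGa_comp_eq_zero` — the algebra behind Case A's `ψ^∨_s = 0` (step (iii) of the note): over a field a
  composite of polynomials vanishing at `0` is zero only if a factor is (`End 𝔾_a = k{F}` has no zero divisors;
  with `ψ_s ∘ ψ^∨_s = [p]_s = 0` on the additive fibre exactly one of `ψ_s, ψ^∨_s` vanishes).

The descent dictionary itself (note §3: for `P ∈ E⁰(H_w)`, `red_w P ≠ 0 ⇔ δ^{ψ∨}_w(P)` is RAMIFIED, via
`ψ̂` iso, `pE₁ = E₂`, `ψ^∨E'⁰(H_w^{nr}) = E₁(H_w^{nr})`; and ramified ⇔ `φ_b(u) ≢ 0 (mod 𝔭_w)` for the Kummer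
element `u` in the `ω^b`-eigenspace, `b = cwIndex ∈ [1, p−2]`, using for `b = 1` that `φ₁ mod 𝔭` kills `U^{(2)}`
hence the unramified class and `φ₁(ζ_p) = 1`) is the CONSTRUCTION of the posited field
`OrdinaryTubeDatum.ordLog_eq_zero_of_kummer` — stub S1/L1 of any line, uniform in the row; it is recorded in
`Ideas/ordinary-cm-torsor-boundary.md`, not typed here (local fields / Néron models absent from the tree).

BSD is not proved by this; Manin `c = 1` is not proved by this.
-/

noncomputable section

set_option linter.dupNamespace false

open WeierstrassCurve Literature.NumberTheory.EllipticCurves.ModularForms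
open Literature.NumberTheory.EllipticCurves

namespace Summit.BirchSwinnertonDyer.BirchSwinnertonDyer.Cruxes.EisensteinAdditiveManinResidual.OrdinaryCMTorsorBoundary

/-! ### Row tables (verbatim from `OrdinaryCMTorsorSketch.lean`, g11 — repeated so that this file is
self-contained; the g11 module is a crux workfile, not a built library module) -/

/-- Tame ramification index `e = 12 / gcd(12, v)` of a potentially good additive fibre, by `v mod 12`. -/
def tameIndex (v : ℕ) : ℕ :=
  match v % 12 with
  | 0 => 1
  | 6 => 2
  | 4 => 3
  | 8 => 3
  | 3 => 4
  | 9 => 4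
  | _ => 6

/-- Principal series (potentially ORDINARY) at `p`: `e ∣ p − 1`. -/
def isPrincipalSeries (p v : ℕ) : Bool := (p - 1) % tameIndex v == 0

/-- Exponent `a` of the g11 Serre pair `{ω^{1+a} (connected), ω^{-a} (étale)}`; `b ≡ −a` below. -/
def etaleExponent (p v : ℕ) : ℕ :=
  (p - 1) / tameIndex v * ((tameIndex v - (v * tameIndex v / 12) % tameIndex v) % tameIndex v)

/-- BOUNDARY row: the connected member `ω^{1+a}` is unramified. -/
def isBoundary (p v : ℕ) : Bool := (1 + etaleExponent p v) % (p - 1) == 0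

/-- Coates–Wiles index `i ≡ −a ≡ b (mod p − 1)`: the `ω^i`-eigenspace carrying the `C'`-torsor class. -/
def cwIndex (p v : ℕ) : ℕ := (p - 1 - etaleExponent p v % (p - 1)) % (p - 1)

/-- The crux rows `(p, v)`, `p ∈ {5, 7, 13, 163}`, `v ∈ {2, 3, 4, 8, 9, 10}`. -/
def cruxRows : List (ℕ × ℕ) :=
  [5, 7, 13, 163].flatMap fun p => [2, 3, 4, 8, 9, 10].map fun v => (p, v)

/-- Sanity: the boundary rows among the principal-series crux rows are `(5,3), (7,2)` (= g11 `boundary_rows`). -/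
theorem boundary_rows' :
    cruxRows.filter (fun pv => isPrincipalSeries pv.1 pv.2 && isBoundary pv.1 pv.2) = [(5, 3), (7, 2)] := by
  decide

/-! ### Lemma A — the cusp-image lemma, E-facing -/

/-- **Lemma A (∞-type cusps).** For `p` odd with `p² ∣ N` (additive reduction at `p`) and ANY modular
parametrisation datum `D` of a curve `W` of conductor `N` (optimal or not), every cusp `a/d` of `X₀(N)` with
`p^{v_p(N)} ∣ d` (the cusps reducing, on the Katz–Mazur model, to the outer component through `∞`) is mapped
by `φ = D.uniformize (c · {∞, ·}_f)` to a point KILLED BY `p`: `φ(a/d) ∈ E⁰(ℚ_p^{nr})_{tors} ↪ 𝔾_a(𝔽̄_p)`.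
(Néron mapping property on the smooth locus of the KM model; KM 13.4.7; Manin–Drinfeld.) [folklore inputs;
statement new — census kit j331280] -/
def InfinityCuspImageKilledByP : Prop :=
  ∀ (W : WeierstrassCurve ℚ) [W.IsElliptic] {N : ℕ} [NeZero N] (D : ModularParametrizationData W N)
    (p : ℕ), p.Prime → 3 ≤ p → p ^ 2 ∣ N →
    ∀ (a : ℤ) (d : ℕ), d ∣ N → p ^ padicValNat p N ∣ d → Int.gcd a d = 1 →
      p • D.uniformize ((D.c : ℂ) * modularSymbol D.f ((a : ℚ) / d)) = 0

/-- **Lemma A (0-type cusps).** Same hypotheses; a cusp `a/d` with `p ∤ d` reduces to the outer component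
through the cusp `0`, so `φ(a/d) − φ(0) ∈ E⁰(ℚ_p^{nr})_{tors}` is killed by `p` (while `φ(0) ∈ E(ℚ)_{tors}` is
unconstrained: `0` and `∞` lie on different components). -/
def ZeroCuspImageDifferenceKilledByP : Prop :=
  ∀ (W : WeierstrassCurve ℚ) [W.IsElliptic] {N : ℕ} [NeZero N] (D : ModularParametrizationData W N)
    (p : ℕ), p.Prime → 3 ≤ p → p ^ 2 ∣ N →
    ∀ (a : ℤ) (d : ℕ), d ∣ N → ¬ p ∣ d → Int.gcd a d = 1 →
      p • (D.uniformize ((D.c : ℂ) * modularSymbol D.f ((a : ℚ) / d)) -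
        D.uniformize ((D.c : ℂ) * modularSymbol D.f 0)) = 0

/-- **Lemma A, sharpened (the cusp exit is closed on irreducible / Case-A non-split rows).** A NON-ZERO image
of an `∞`-type cusp is a point of `E[p]^{I_p}` rational over `ℚ(ζ_g)`, `g ∣ N/p²`, `p ∤ g`; since
`ℚ(E[p]) ⊇ ℚ(ζ_p) ⊄ ℚ(ζ_g)`, the fixed line `E[p]^{G_{ℚ(ζ_g)}}` is a `G_ℚ`-stable line: `E[p]` is reducible.
(E-facing consequence typed; the local statement `φ(a/d) ∈ E[p]^{I_p}` is the informative one: it is `0` off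
the rows with `E(ℚ_p^{nr})[p] ≠ 0`, i.e. off the boundary principal-series rows `(5,3), (7,2)` and the `p = 5`,
`e = 6` rows `(5,2), (5,10)` — cf. `50b1`.) -/
def InfinityCuspImageNonzeroOnlyIfReducible : Prop :=
  ∀ (W : WeierstrassCurve ℚ) [W.IsElliptic] {N : ℕ} [NeZero N] (D : ModularParametrizationData W N)
    (p : ℕ), p.Prime → 3 ≤ p → p ^ 2 ∣ N →
    ∀ (a : ℤ) (d : ℕ), d ∣ N → p ^ padicValNat p N ∣ d → Int.gcd a d = 1 →
      D.uniformize ((D.c : ℂ) * modularSymbol D.f ((a : ℚ) / d)) ≠ 0 → ¬ W.HasIrreducibleModPGaloisRep p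

/-- The sharpened form implies: on a curve with irreducible `E[p]` every `∞`-type cusp maps to `O`
(bookkeeping only — recorded to show the two typed forms compose). -/
theorem infinityCusp_eq_zero_of_irreducible (h : InfinityCuspImageNonzeroOnlyIfReducible)
    (W : WeierstrassCurve ℚ) [W.IsElliptic] {N : ℕ} [NeZero N] (D : ModularParametrizationData W N)
    (p : ℕ) (hp : p.Prime) (h3 : 3 ≤ p) (hN : p ^ 2 ∣ N) (hirr : W.HasIrreducibleModPGaloisRep p)
    (a : ℤ) (d : ℕ) (hd : d ∣ N) (hpd : p ^ padicValNat p N ∣ d) (hg : Int.gcd a d = 1) :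
    D.uniformize ((D.c : ℂ) * modularSymbol D.f ((a : ℚ) / d)) = 0 := by
  by_contra hne
  exact h W D p hp h3 hN a d hd hpd hg hne hirr

/-! ### Row bookkeeping: the Coates–Wiles index is uniform, the boundary is `φ₁` -/

/-- On EVERY principal-series crux row (boundary included) the Coates–Wiles index `i = cwIndex p v` lies in
`[1, p − 2]`: it is never the unramified exponent `0`, so `φ_i` is always one of the Coates–Wiles homomorphisms
`φ_k`, `k ≥ 1` (Lang, Cyclotomic Fields I–II, Ch. 6 §4). -/
theorem cwIndex_uniform :
    (cruxRows.filter fun pv => isPrincipalSeries pv.1 pv.2).all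
      (fun pv => decide (1 ≤ cwIndex pv.1 pv.2 ∧ cwIndex pv.1 pv.2 ≤ pv.1 - 2)) = true := by
  decide

/-- The boundary rows are exactly the principal-series rows with tame index `e = p − 1` and `cwIndex = 1`
(Serre pair `{ω⁰·unr (connected), ω¹·unr (étale)}`; the test functional is the ORIGINAL Coates–Wiles
homomorphism `φ₁`, whose reduction mod `𝔭` kills `U^{(2)} ∋` the unramified Kummer class and sends `ζ_p ↦ 1`). -/
theorem boundary_profile :
    (cruxRows.filter fun pv => isPrincipalSeries pv.1 pv.2).all
      (fun pv => isBoundary pv.1 pv.2 == (tameIndex pv.2 == pv.1 - 1 && cwIndex pv.1 pv.2 == 1)) = true := by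
  decide

/-- The crux rows at `p ∈ {5, 7, 13}` with `e ≥ p − 1` (Raynaud's uniqueness bound `e < p − 1` fails; the
height-one formal-group computation of the inertia characters is unaffected): `(5; v = 2, 3, 9, 10)` and
`(7; v = 2, 10)`; none at `p = 13`.  The `p = 5`, `e = 6` rows `(5,2), (5,10)` are the supercuspidal rows on which
`E(ℚ_5^{nr})[5] ≠ 0` does occur (`50b1`), outside this card's principal-series scope. -/
theorem raynaudBorderline_rows :
    (cruxRows.filter fun pv => pv.1 ≠ 163 && decide (pv.1 ≤ tameIndex pv.2 + 1)) =
      [(5, 2), (5, 3), (5, 9), (5, 10), (7, 2), (7, 10)] := by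
  decide

/-! ### The algebra of Case A, step (iii): `End 𝔾_a` has no zero divisors -/

/-- Over a field, if `f ∘ g = 0` for polynomials with `g(0) = 0` then `f = 0` or `g = 0`.  Applied to the
additive polynomials `ψ_s, ψ^∨_s ∈ End(𝔾_{a,k}) = k{F}` induced on the identity components of the additive
special fibres, with `ψ_s ∘ ψ^∨_s = [p]_s = 0`: exactly one of them vanishes (they cannot both vanish since
`α_ψ α_{ψ∨} = p` has valuation `1` over the unramified base), and in Case A (the rational line `C` étale-type)
it is `ψ^∨_s` — whence `α_ψ` is a unit and `ψ̂` is an isomorphism of Néron formal groups. -/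
theorem endGa_comp_eq_zero {k : Type*} [Field k] {f g : Polynomial k} (hg : g.eval 0 = 0)
    (h : f.comp g = 0) : f = 0 ∨ g = 0 := by
  rcases Polynomial.comp_eq_zero_iff.mp h with hf | ⟨_, hg'⟩
  · exact Or.inl hf
  · right
    rw [hg', ← Polynomial.coeff_zero_eq_eval_zero] at hg
    rw [hg', Polynomial.coeff_zero_eq_eval_zero, ← Polynomial.coeff_zero_eq_eval_zero]
    simpa using congrArg Polynomial.C hg

end Summit.BirchSwinnertonDyer.BirchSwinnertonDyer.Cruxes.EisensteinAdditiveManinResidual.OrdinaryCMTorsorBoundary
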